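import Summits.AnomalousDissipation.AnomalousDissipation.Theses.TwoAndHalfD
import Literature.Analysis.FluidPDE.TorusClassicalLerayHopfProofs
import Literature.Analysis.FluidPDE.LongTimeAverageSlidingWindow
import Literature.Barriers.AnomalousDissipation.GravestModeLaminarAttractorSwept
import Summits.AnomalousDissipation.AnomalousDissipation.Theorems.ScalarAnomalySteadySourceFormal.Negative.ForcedClassicalWeak
import Summits.AnomalousDissipation.AnomalousDissipation.Theorems.TwoAndHalfDScalarAnomalySteadySourceFormalColdStartVariance
import Summits.AnomalousDissipation.AnomalousDissipation.Theorems.TwoAndHalfDTwohalfdThesisStubWeakDuhamel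
import Summits.AnomalousDissipation.AnomalousDissipation.Theorems.TwoAndHalfDScalarAnomalySteadySourceFormalReleaseNormSqMeasurable
import Summits.AnomalousDissipation.AnomalousDissipation.Theorems.TwoAndHalfDScalarAnomalySteadySourceFormalMeanSquareDuhamelVariance
import Summits.AnomalousDissipation.AnomalousDissipation.Theorems.TwoAndHalfDScalarAnomalySteadySourceFormalDissipationFloorOfMeanVariance
import Summits.AnomalousDissipation.AnomalousDissipation.Theorems.TwoAndHalfDScalarAnomalySteadySourceFormalMeanSquareOfReleasedMixingWitness
import Summits.AnomalousDissipation.AnomalousDissipation.Theorems.TwoAndHalfDTwohalfdThesisSiblingReduction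

/-!
# The STATISTICAL KERNEL S1'' closes crux #2 (and the route target X): transfer `stub_meanSquareMixerTransfer`

Transfer file of the line `budgeted-mixer-template`, RESHAPE r2 (lead c2, 2026-08-17), for the crux
`Summit.AnomalousDissipation.AnomalousDissipation.Theses.TwoAndHalfD.ScalarAnomalySteadySourceFormal`
(stmt-AnomalousDissipation-0448).  The line's checked skeleton `Cruxes/ScalarAnomalySteadySourceFormal/Lines/budgeted_mixer_template.lean`
has ONE `sorry`, the residual S1'' `stub_meanSquareMixerRealizable`; this file is its composition with the residual as a
HYPOTHESIS, kernel-checked in the tree: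

* `scalarAnomalySteadySourceFormal_of_meanSquareMixer` — S1''-body ⇒ crux #2 BY NAME.  S1'' = a steadily forced classical
  planar NS family `v_j` (ONE steady smooth `g`, pointwise energy `≤ E`), the classical releases `φ_j s` of ONE smooth
  mean-zero profile `h`, MEAN-SQUARE decay of the releases averaged over the release time
  (`∫_{s₀}^{T} ‖φ_j s (s+τ)‖² ds ≤ (B + T − s₀)·m(τ)²‖h‖²`, `m > 0` antitone, `∫₀ᵗ m ≤ M`) and the Green–Kubo floor in
  liminf mean.  Ingredients (all landed): cold starts `ColdStartVariance.exists_global_coldStart`; D0 weak Duhamel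
  `TwohalfdThesis.stub_weakDuhamel` (p87403); T3a `ReleaseNormSqMeasurable.stub_releaseNormSqMeasurable` (p147918, joint
  Borel measurability of the release norms: duality + Carathéodory + Parseval); T3
  `MeanSquareDuhamelVariance.stub_meanSquareDuhamelVariance` (p149045: `∫₀ᵀ‖θ_j‖² ≤ (2s₀²T + 2M²(B+T))‖h‖²` by
  Cauchy–Schwarz with the weight `m` and ONE Tonelli swap on the release triangle); D2'
  `DissipationFloorOfMeanVariance.stub_dissipationFloorOfMeanVariance` (p149892: dissipation floor from liminf-mean power
  and a linearly growing integrated variance, `‖θ(T)‖² = o(T)`); `longTimeAvgSup_le_of_integral_le_linear` (Cesàro).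
* `twohalfdThesis_of_meanSquareMixer` — the same package closes the route TARGET `TwohalfdThesis` (crux 0206) through the
  landed sibling identification `twohalfdThesis_of_scalarAnomalySteadySourceFormal`.
* `meanSquareMixer_of_profileMixerRealizable` — S1' ⇒ S1'' (J2 `stub_releasedMixingWitness_of_profileMixerRealizable`,
  p132866, then J3 `stub_meanSquare_of_releasedMixingWitness`, p151094); with J3 itself (W ⇒ S1'') the statistical kernel
  S1'' is the WEAKEST of the three typed kernels S1', W, S1'' of route `TwoAndHalfD`, and every no-go for S1'' kills all.
* `stub_meanSquareMixerTransfer` — the registered transfer stub (S1''-body → crux), by name.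
No new mathematics beyond the cited stubs; bookkeeping over landed theorems.  Supports stmt-AnomalousDissipation-0448.
[folklore: Duhamel / Green–Kubo bookkeeping, Doering–Foias 2002 §2 budgets]
-/

noncomputable section

-- D-0017: single-problem summit ⇒ `Summit.AnomalousDissipation.AnomalousDissipation.…` duplicates a namespace component
set_option linter.dupNamespace false

namespace Summit.AnomalousDissipation.AnomalousDissipation.Theorems.ScalarAnomalySteadySourceFormal.MeanSquareMixerTransfer

open MeasureTheory Filter Topology Set
open scoped ENNReal NNReal
open Literature.Analysis.FunctionSpaces Literature.Analysis.FluidPDE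
open Summit.AnomalousDissipation.AnomalousDissipation.Theses.TwoAndHalfD

/-! ## Cesàro bookkeeping -/

/-- If `f ≥ 0` and `∫₀ᵀ f ≤ a + bT` for all `T ≥ 0`, then `⟨f⟩ = limsup_T T⁻¹∫₀ᵀ f ≤ b` (the running means are
`≤ a/T + b`, eventually `≤ b + δ` for every `δ > 0`; nonnegativity supplies the coboundedness of the real `limsup`,
`longTimeAvgSup_le_of_eventually_le`). [folklore] -/
theorem longTimeAvgSup_le_of_integral_le_linear {f : ℝ → ℝ} {a b : ℝ} (hf : ∀ t, 0 ≤ f t)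
    (hint : ∀ T, 0 ≤ T → ∫ t in (0 : ℝ)..T, f t ≤ a + b * T) : longTimeAvgSup f ≤ b := by
  refine le_of_forall_pos_le_add fun δ hδ => ?_
  apply longTimeAvgSup_le_of_eventually_le hf
  have ha : 0 ≤ a := by simpa using hint 0 le_rfl
  filter_upwards [eventually_ge_atTop (max 1 (a / δ))] with T hT
  have hT1 : 1 ≤ T := le_trans (le_max_left _ _) hT
  have hT0 : 0 < T := lt_of_lt_of_le one_pos hT1
  have hTa : a / δ ≤ T := le_trans (le_max_right _ _) hT
  have haT : a ≤ δ * T := by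
    rw [div_le_iff₀ hδ] at hTa
    linarith [mul_comm T δ]
  unfold timeMean
  rw [inv_mul_le_iff₀ hT0]
  calc ∫ t in (0 : ℝ)..T, f t ≤ a + b * T := hint T hT0.le
    _ ≤ δ * T + b * T := by linarith
    _ = T * (b + δ) := by ring

/-! ## S1''-body ⇒ crux #2 -/

/-- **S1'' ⇒ crux #2 `ScalarAnomalySteadySourceFormal` BY NAME.**  From the statistical kernel: cold starts `θ_j`
(`exists_global_coldStart`), weak Duhamel (D0), measurable release norms (T3a), integrated variance
`∫₀ᵀ‖θ_j‖² ≤ (2s₀²T + 2M²(B+T))‖h‖²` (T3) hence limsup-mean variance `≤ (2s₀² + 2M²)‖h‖²`, Green–Kubo floor = liminf-mean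
input power (D0 with `χ = h`), dissipation floor (D2'); classical NS ⇒ global Leray–Hopf from its own slice, classical cold
start ⇒ weak sourced solution from the zero datum, pointwise energy ⇒ `meanEnergy ≤ E`. -/
theorem scalarAnomalySteadySourceFormal_of_meanSquareMixer
    (hS : ∃ (g : UnitAddTorus (Fin 2) → EuclideanSpace ℝ (Fin 2)) (h : UnitAddTorus (Fin 2) → ℝ),
        Torus.IsSmooth g ∧ Torus.IsDivFree g ∧ Torus.HasZeroMean g ∧ Torus.IsSmooth h ∧ Torus.HasZeroMean h ∧
        ∃ (ν : ℕ → ℝ) (v : ℕ → ℝ → UnitAddTorus (Fin 2) → EuclideanSpace ℝ (Fin 2))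
          (p : ℕ → ℝ → UnitAddTorus (Fin 2) → ℝ) (φ : ℕ → ℝ → ℝ → UnitAddTorus (Fin 2) → ℝ)
          (m : ℝ → ℝ) (E s₀ B M ε : ℝ),
          (∀ j, 0 < ν j) ∧ Tendsto ν atTop (𝓝 0) ∧
          (∀ j, Torus.IsClassicalNSSolutionOn (Set.Ici 0) (ν j) (fun _ => g) (v j) (p j)) ∧
          (∀ j t, 0 ≤ t → ∫ x, ‖v j t x‖ ^ 2 ≤ E) ∧
          (∀ j s, 0 ≤ s → Torus.IsClassicalScalarTransportOn (Set.Ici s) (ν j) (v j) (φ j s) ∧ φ j s s = h) ∧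
          0 ≤ s₀ ∧ 0 ≤ B ∧ Antitone m ∧ (∀ τ, 0 < m τ) ∧ (∀ t, 0 ≤ t → ∫ τ in (0 : ℝ)..t, m τ ≤ M) ∧
          (∀ j τ T, 0 ≤ τ → s₀ ≤ T →
            ∫ s in s₀..T, Torus.scalarL2Sq (φ j s (s + τ)) ≤ (B + (T - s₀)) * m τ ^ 2 * Torus.scalarL2Sq h) ∧
          0 < ε ∧
          (∀ j, ε ≤ liminf (timeMean fun t => ∫ s in (0 : ℝ)..t, ∫ x, h x * φ j s t x) atTop) ) :
    ScalarAnomalySteadySourceFormal := by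
  obtain ⟨g, h, hgs, hgd, hgm, hhs, hhm, ν, v, p, φ, m, E, s₀, B, M, ε, hν, hν0, hNS, hE, hφ, hs₀, hB, hanti, hpos,
    hM, hMS, hε, hGK⟩ := hS
  -- the classical cold starts `θ_j`
  have hex : ∀ j, ∃ θ : ℝ → UnitAddTorus (Fin 2) → ℝ,
      Torus.IsClassicalScalarTransportForcedOn (Set.Ici 0) (ν j) (v j) (fun _ => h) θ ∧ θ 0 = fun _ => 0 := fun j =>
    Summit.AnomalousDissipation.AnomalousDissipation.Theorems.ScalarAnomalySteadySourceFormal.ColdStartVariance.exists_global_coldStart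
      (hν j) (hNS j).smooth_velocity (hNS j).divFree hhs
  choose θ hθ hθ0 using hex
  -- D0 (landed): the weak Duhamel identity
  have hId : ∀ j (χ : UnitAddTorus (Fin 2) → ℝ), Torus.IsSmooth χ → ∀ t, 0 ≤ t →
      ∫ x, θ j t x * χ x = ∫ s in (0 : ℝ)..t, ∫ x, φ j s t x * χ x := fun j =>
    Summit.AnomalousDissipation.AnomalousDissipation.Theorems.TwohalfdThesis.stub_weakDuhamel
      (ν j) (v j) h (θ j) (φ j) (hν j) hhs (hθ j) (hθ0 j) (hφ j)
  -- T3a: measurable versions of the release norms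
  have hG : ∀ j, ∃ G : ℝ × ℝ → ℝ, Measurable G ∧
      ∀ s t, 0 ≤ s → s ≤ t → G (s, t) = Torus.scalarL2Sq (φ j s t) := fun j =>
    ReleaseNormSqMeasurable.stub_releaseNormSqMeasurable (ν j) (v j) h (φ j) (hν j) hhs (hφ j)
  choose G hGm hGeq using hG
  -- T3: the integrated variance grows at most linearly
  have hInt : ∀ j T, 0 ≤ T → ∫ t in (0 : ℝ)..T, Torus.scalarL2Sq (θ j t) ≤
      (2 * s₀ ^ 2 * T + 2 * M ^ 2 * (B + T)) * Torus.scalarL2Sq h := fun j =>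
    MeanSquareDuhamelVariance.stub_meanSquareDuhamelVariance (ν j) s₀ B M (v j) h (θ j) (φ j) m (G j) (hν j) hhs (hθ j) (hθ0 j) (hφ j)
      (hId j) (hGm j) (hGeq j) hs₀ hB hanti hpos hM (hMS j)
  have hInt' : ∀ j T, 0 ≤ T → ∫ t in (0 : ℝ)..T, Torus.scalarL2Sq (θ j t) ≤
      2 * M ^ 2 * B * Torus.scalarL2Sq h + (2 * s₀ ^ 2 + 2 * M ^ 2) * Torus.scalarL2Sq h * T := by
    intro j T hT
    have := hInt j T hT
    have e : (2 * s₀ ^ 2 * T + 2 * M ^ 2 * (B + T)) * Torus.scalarL2Sq h =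
        2 * M ^ 2 * B * Torus.scalarL2Sq h + (2 * s₀ ^ 2 + 2 * M ^ 2) * Torus.scalarL2Sq h * T := by ring
    linarith
  -- limsup-mean variance
  have hVar : ∀ j, longTimeAvgSup (fun t => Torus.scalarL2Sq (θ j t)) ≤
      (2 * s₀ ^ 2 + 2 * M ^ 2) * Torus.scalarL2Sq h := fun j =>
    longTimeAvgSup_le_of_integral_le_linear (fun t => Torus.scalarL2Sq_nonneg _) (hInt' j)
  -- the Green–Kubo floor is an input-power floor (D0 with `χ = h`)
  have hPow : ∀ j, ε ≤ liminf (timeMean fun t => ∫ x, h x * θ j t x) atTop := by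
    intro j
    have heq : (timeMean fun t => ∫ s in (0 : ℝ)..t, ∫ x, h x * φ j s t x) =ᶠ[atTop]
        (timeMean fun t => ∫ x, h x * θ j t x) := by
      filter_upwards [eventually_ge_atTop (0 : ℝ)] with T hT
      unfold timeMean
      congr 1
      refine intervalIntegral.integral_congr fun t ht => ?_
      rw [uIcc_of_le hT] at ht
      have e := hId j h hhs t ht.1
      simp_rw [mul_comm (h _)]
      exact e.symm
    rw [← Filter.liminf_congr heq]
    exact hGK j
  -- D2': the dissipation floor
  have hDiss : ∀ j, ε ≤ longTimeAvgSup (fun t => ν j * (Torus.eScalarGradNormSq (θ j t)).toReal) := fun j =>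
    DissipationFloorOfMeanVariance.stub_dissipationFloorOfMeanVariance (ν j) (2 * M ^ 2 * B * Torus.scalarL2Sq h)
      ((2 * s₀ ^ 2 + 2 * M ^ 2) * Torus.scalarL2Sq h) ε (v j) h (θ j) (hν j).le hhs (hθ j) (hInt' j) (hPow j)
  -- assemble the crux with data `v j 0`, `θ j 0`
  refine ⟨g, h, hgs, hgd, hgm, hhs, hhm, ν, fun j => v j 0, v, fun j => θ j 0, θ, hν, hν0, ?_, ?_, ?_,
    ⟨E, fun j => ?_⟩, ⟨(2 * s₀ ^ 2 + 2 * M ^ 2) * Torus.scalarL2Sq h, hVar⟩, ε, hε, hDiss⟩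
  · -- classical NS on `[0, ∞)` ⇒ global Leray–Hopf with datum `v j 0`
    intro j T hT
    exact (hNS j).isLerayHopfOn_of_convex (convex_Ici 0) hT Set.Icc_subset_Ici_self
  · -- the zero datum is in `L²`
    intro j
    exact ((hθ j).smooth_scalar.isSmooth_slice (le_refl (0 : ℝ))).memLp 2
  · -- classical cold start ⇒ global weak sourced solution
    intro j T _hT
    exact Summit.AnomalousDissipation.AnomalousDissipation.Theorems.ScalarAnomalySteadySourceFormal.Negative.isWeakScalarTransportForcedOn_of_classical
      (hθ j) Set.Icc_subset_Ici_self
  · -- pointwise energy bound ⇒ limsup-mean energy bound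
    exact Literature.Barriers.AnomalousDissipation.meanEnergy_le_of_forall_le fun t ht => hE j t ht.le


/-- **S1'' ⇒ the route target `TwohalfdThesis` (crux 0206)** through the landed sibling identification
`TwohalfdThesis.twohalfdThesis_of_scalarAnomalySteadySourceFormal` (`X ↔ #2`). -/
theorem twohalfdThesis_of_meanSquareMixer
    (hS : ∃ (g : UnitAddTorus (Fin 2) → EuclideanSpace ℝ (Fin 2)) (h : UnitAddTorus (Fin 2) → ℝ),
        Torus.IsSmooth g ∧ Torus.IsDivFree g ∧ Torus.HasZeroMean g ∧ Torus.IsSmooth h ∧ Torus.HasZeroMean h ∧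
        ∃ (ν : ℕ → ℝ) (v : ℕ → ℝ → UnitAddTorus (Fin 2) → EuclideanSpace ℝ (Fin 2))
          (p : ℕ → ℝ → UnitAddTorus (Fin 2) → ℝ) (φ : ℕ → ℝ → ℝ → UnitAddTorus (Fin 2) → ℝ)
          (m : ℝ → ℝ) (E s₀ B M ε : ℝ),
          (∀ j, 0 < ν j) ∧ Tendsto ν atTop (𝓝 0) ∧
          (∀ j, Torus.IsClassicalNSSolutionOn (Set.Ici 0) (ν j) (fun _ => g) (v j) (p j)) ∧
          (∀ j t, 0 ≤ t → ∫ x, ‖v j t x‖ ^ 2 ≤ E) ∧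
          (∀ j s, 0 ≤ s → Torus.IsClassicalScalarTransportOn (Set.Ici s) (ν j) (v j) (φ j s) ∧ φ j s s = h) ∧
          0 ≤ s₀ ∧ 0 ≤ B ∧ Antitone m ∧ (∀ τ, 0 < m τ) ∧ (∀ t, 0 ≤ t → ∫ τ in (0 : ℝ)..t, m τ ≤ M) ∧
          (∀ j τ T, 0 ≤ τ → s₀ ≤ T →
            ∫ s in s₀..T, Torus.scalarL2Sq (φ j s (s + τ)) ≤ (B + (T - s₀)) * m τ ^ 2 * Torus.scalarL2Sq h) ∧
          0 < ε ∧
          (∀ j, ε ≤ liminf (timeMean fun t => ∫ s in (0 : ℝ)..t, ∫ x, h x * φ j s t x) atTop) ) :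
    TwohalfdThesis :=
  TwohalfdThesis.twohalfdThesis_of_scalarAnomalySteadySourceFormal (scalarAnomalySteadySourceFormal_of_meanSquareMixer hS)

/-! ## S1' ⇒ S1'': the statistical kernel is the weakest typed kernel of the route -/

/-- **S1' ⇒ S1''.**  The profile-wise kernel S1' of reshape r1 (`stub_profileMixerRealizable`, verbatim as the hypothesis)
implies the statistical kernel S1'' (verbatim as the conclusion): J2 (`TwohalfdThesis.stub_releasedMixingWitness_of_profileMixerRealizable`,
S1' ⇒ W) followed by J3 (`MeanSquareOfReleasedMixingWitness.stub_meanSquare_of_releasedMixingWitness`, W ⇒ S1''). -/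
theorem meanSquareMixer_of_profileMixerRealizable
    (hS1 : (∃ (g : UnitAddTorus (Fin 2) → EuclideanSpace ℝ (Fin 2)) (h : UnitAddTorus (Fin 2) → ℝ),
        Torus.IsSmooth g ∧ Torus.IsDivFree g ∧ Torus.HasZeroMean g ∧ Torus.IsSmooth h ∧ Torus.HasZeroMean h ∧
        ∃ (ν : ℕ → ℝ) (v : ℕ → ℝ → UnitAddTorus (Fin 2) → EuclideanSpace ℝ (Fin 2))
          (p : ℕ → ℝ → UnitAddTorus (Fin 2) → ℝ) (ρm : ℝ → ℝ) (E R L c₀ : ℝ),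
          (∀ j, 0 < ν j) ∧ Tendsto ν atTop (𝓝 0) ∧ 0 < L ∧ 0 < c₀ ∧ Antitone ρm ∧ (∀ r, 0 ≤ ρm r) ∧
          (∀ t, 0 ≤ t → ∫ r in (0 : ℝ)..t, ρm r ≤ R) ∧
          (∀ t, L ≤ t → Torus.scalarL2Sq h * ∫ r in L..t, ρm r ≤ c₀ / 2) ∧
          (∀ j, Torus.IsClassicalNSSolutionOn (Set.Ici 0) (ν j) (fun _ => g) (v j) (p j)) ∧
          (∀ j t, 0 ≤ t → ∫ x, ‖v j t x‖ ^ 2 ≤ E) ∧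
          (∀ j (s T' : ℝ), 0 ≤ s → ∀ φ : ℝ → UnitAddTorus (Fin 2) → ℝ,
            Torus.IsClassicalScalarTransportOn (Set.Icc s T') (ν j) (v j) φ → φ s = h →
            ∀ t ∈ Set.Icc s T', Torus.scalarL2Sq (φ t) ≤ ρm (t - s) ^ 2 * Torus.scalarL2Sq h) ∧
          (∀ j (s : ℝ), 0 ≤ s → ∀ θ' : ℝ → UnitAddTorus (Fin 2) → ℝ,
            Torus.IsClassicalScalarTransportForcedOn (Set.Icc s (s + L)) (ν j) (v j) (fun _ => h) θ' →
            θ' s = (fun _ => (0 : ℝ)) → c₀ ≤ ∫ x, h x * θ' (s + L) x))) :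
    ∃ (g : UnitAddTorus (Fin 2) → EuclideanSpace ℝ (Fin 2)) (h : UnitAddTorus (Fin 2) → ℝ),
      Torus.IsSmooth g ∧ Torus.IsDivFree g ∧ Torus.HasZeroMean g ∧ Torus.IsSmooth h ∧ Torus.HasZeroMean h ∧
      ∃ (ν : ℕ → ℝ) (v : ℕ → ℝ → UnitAddTorus (Fin 2) → EuclideanSpace ℝ (Fin 2))
        (p : ℕ → ℝ → UnitAddTorus (Fin 2) → ℝ) (φ : ℕ → ℝ → ℝ → UnitAddTorus (Fin 2) → ℝ)
        (m : ℝ → ℝ) (E s₀ B M ε : ℝ),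
        (∀ j, 0 < ν j) ∧ Tendsto ν atTop (𝓝 0) ∧
        (∀ j, Torus.IsClassicalNSSolutionOn (Set.Ici 0) (ν j) (fun _ => g) (v j) (p j)) ∧
        (∀ j t, 0 ≤ t → ∫ x, ‖v j t x‖ ^ 2 ≤ E) ∧
        (∀ j s, 0 ≤ s → Torus.IsClassicalScalarTransportOn (Set.Ici s) (ν j) (v j) (φ j s) ∧ φ j s s = h) ∧
        0 ≤ s₀ ∧ 0 ≤ B ∧ Antitone m ∧ (∀ τ, 0 < m τ) ∧ (∀ t, 0 ≤ t → ∫ τ in (0 : ℝ)..t, m τ ≤ M) ∧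
        (∀ j τ T, 0 ≤ τ → s₀ ≤ T →
          ∫ s in s₀..T, Torus.scalarL2Sq (φ j s (s + τ)) ≤ (B + (T - s₀)) * m τ ^ 2 * Torus.scalarL2Sq h) ∧
        0 < ε ∧
        (∀ j, ε ≤ liminf (timeMean fun t => ∫ s in (0 : ℝ)..t, ∫ x, h x * φ j s t x) atTop)  :=
  MeanSquareOfReleasedMixingWitness.stub_meanSquare_of_releasedMixingWitness
    (TwohalfdThesis.stub_releasedMixingWitness_of_profileMixerRealizable hS1)

/-! ## The registered transfer stub -/

/-- **`stub_meanSquareMixerTransfer`** (registered on stmt-AnomalousDissipation-0448: the transfer `C⁺ ⇒ crux` of the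
line `budgeted-mixer-template`, reshape r2): the S1''-body implies `ScalarAnomalySteadySourceFormal`. -/
theorem stub_meanSquareMixerTransfer :
    (∃ (g : UnitAddTorus (Fin 2) → EuclideanSpace ℝ (Fin 2)) (h : UnitAddTorus (Fin 2) → ℝ),
      Torus.IsSmooth g ∧ Torus.IsDivFree g ∧ Torus.HasZeroMean g ∧ Torus.IsSmooth h ∧ Torus.HasZeroMean h ∧
      ∃ (ν : ℕ → ℝ) (v : ℕ → ℝ → UnitAddTorus (Fin 2) → EuclideanSpace ℝ (Fin 2))
        (p : ℕ → ℝ → UnitAddTorus (Fin 2) → ℝ) (φ : ℕ → ℝ → ℝ → UnitAddTorus (Fin 2) → ℝ)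
        (m : ℝ → ℝ) (E s₀ B M ε : ℝ),
        (∀ j, 0 < ν j) ∧ Tendsto ν atTop (𝓝 0) ∧
        (∀ j, Torus.IsClassicalNSSolutionOn (Set.Ici 0) (ν j) (fun _ => g) (v j) (p j)) ∧
        (∀ j t, 0 ≤ t → ∫ x, ‖v j t x‖ ^ 2 ≤ E) ∧
        (∀ j s, 0 ≤ s → Torus.IsClassicalScalarTransportOn (Set.Ici s) (ν j) (v j) (φ j s) ∧ φ j s s = h) ∧
        0 ≤ s₀ ∧ 0 ≤ B ∧ Antitone m ∧ (∀ τ, 0 < m τ) ∧ (∀ t, 0 ≤ t → ∫ τ in (0 : ℝ)..t, m τ ≤ M) ∧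
        (∀ j τ T, 0 ≤ τ → s₀ ≤ T →
          ∫ s in s₀..T, Torus.scalarL2Sq (φ j s (s + τ)) ≤ (B + (T - s₀)) * m τ ^ 2 * Torus.scalarL2Sq h) ∧
        0 < ε ∧
        (∀ j, ε ≤ liminf (timeMean fun t => ∫ s in (0 : ℝ)..t, ∫ x, h x * φ j s t x) atTop)) →
    Summit.AnomalousDissipation.AnomalousDissipation.Theses.TwoAndHalfD.ScalarAnomalySteadySourceFormal :=
  fun hS => scalarAnomalySteadySourceFormal_of_meanSquareMixer hS

end Summit.AnomalousDissipation.AnomalousDissipation.Theorems.ScalarAnomalySteadySourceFormal.MeanSquareMixerTransfer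

end
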